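import Literature.Analysis.FluidPDE.RepresentedDerivatives
import Literature.Analysis.FluidPDE.HelmholtzAnnihilator
import HarnessLib

/-!
# Represented derivatives: commutation rules, differentiated equations, and the product rule

Analysis/FluidPDE proofs file (theorems only; no definitions, no named facts), sequel of
`RepresentedDerivatives.lean` (`RepDeriv.derivs`, `RepDeriv.IsRepDeriv`). It supplies the three
rules that drive the induction "one more derivative per level" for distributional solutions
(Serrin 1962; Lemarié-Rieusset 2016, Thm. 13.1, Steps 2–3: "as `∂ₜ(∂ⱼω) = νΔ(∂ⱼω) + ∂ⱼg`, this
is done by induction on `k`"; Seregin–Šverák 2009, §2 p. 8):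

* **commutation on test functions** (Schwarz): `derivs` depends only on the multiset of
  directions (`derivs_perm`), the last direction can be moved in front
  (`derivs_cons_eq_fderiv_derivs`), and `derivs` commutes with the slice Laplacian and the time
  derivative (`derivs_laplacian`, `derivs_timeDeriv`, `derivs_heatOp`);
* **differentiated weak identities**: if `h` solves `∂ₜh - Δh = div g` (resp. `Δh = div F`,
  resp. a first-order identity `Σ ∫ h_m ∂_{w_m}ψ = 0`) in `𝒟'(Q)` and `f`, `Gᵢ` represent
  `∂^{vs}h`, `∂^{vs}gᵢ`, then `f` solves the same equation with the differentiated flux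
  (`IsRepDeriv.heat_identity`, `IsRepDeriv.poisson_identity`, `IsRepDeriv.sum_firstOrder_identity`);
* **the product rule** for weak spatial derivatives of essentially bounded functions
  (`IsRepDeriv.mul`; Gilbarg–Trudinger 2001, (7.18)), proved by mollification in space–time
  (`fderiv_mollified_slice_eq`: the derivative of the mollification is the mollification of the
  weak derivative inside; dominated convergence and `L¹` convergence of mollifications).

## References

* D. Gilbarg, N. S. Trudinger, *Elliptic Partial Differential Equations of Second Order* (2001),
  §7.2–7.3, Lemma 7.3, (7.18). [`GilbargTrudinger2001`]
* L. Schwartz, *Théorie des distributions* (1950–51), Ch. II §1–2. [folklore]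
* P. G. Lemarié-Rieusset, *The Navier–Stokes Problem in the 21st Century* (2016), Thm. 13.1.
  [`LemarieRieusset2016`]
* G. Seregin, V. Šverák, Comm. PDE 34 (2009) = arXiv:0804.1803, §2 p. 8. [`SereginSverak2009`]
-/

noncomputable section

open MeasureTheory Set Function Filter Topology TopologicalSpace Metric
open scoped NNReal ENNReal Convolution

namespace Literature.Analysis.FluidPDE

namespace RepDeriv

/-! ## Commutation of `derivs` with `Δ`, `∂ₜ`; differentiated weak identities -/

section Commute

open scoped Laplacian

variable {E : Type*} [NormedAddCommGroup E] [InnerProductSpace ℝ E]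

/-- Slices of a jointly smooth space–time field are smooth. [folklore] -/
theorem contDiff_slice {F : Type*} [NormedAddCommGroup F] [NormedSpace ℝ F] {ψ : ℝ → E → F}
    (h : ContDiff ℝ ((⊤ : ℕ∞) : WithTop ℕ∞) (uncurry ψ)) (t : ℝ) :
    ContDiff ℝ ((⊤ : ℕ∞) : WithTop ℕ∞) (ψ t) :=
  h.comp (contDiff_prodMk_right t)

/-- The directional slice derivative of a jointly smooth field is jointly smooth. [folklore] -/
theorem contDiff_uncurry_fderiv_apply {F : Type*} [NormedAddCommGroup F] [NormedSpace ℝ F]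
    {ψ : ℝ → E → F} (h : ContDiff ℝ ((⊤ : ℕ∞) : WithTop ℕ∞) (uncurry ψ)) (v : E) :
    ContDiff ℝ ((⊤ : ℕ∞) : WithTop ℕ∞) (uncurry fun t x => fderiv ℝ (ψ t) x v) := by
  have h' := (IsSmoothSpaceTimeOn.isSmoothSpaceTimeOn_fderiv_apply (S := univ) (w := ψ)
    (by rw [IsSmoothSpaceTimeOn, univ_prod_univ, contDiffOn_univ]; exact h) isOpen_univ v)
  rw [IsSmoothSpaceTimeOn, univ_prod_univ, contDiffOn_univ] at h'
  exact h'

/-- `derivs` of a jointly smooth field is jointly smooth. [folklore] -/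
theorem contDiff_uncurry_derivs {F : Type*} [NormedAddCommGroup F] [NormedSpace ℝ F] (vs : List E)
    {ψ : ℝ → E → F} (h : ContDiff ℝ ((⊤ : ℕ∞) : WithTop ℕ∞) (uncurry ψ)) :
    ContDiff ℝ ((⊤ : ℕ∞) : WithTop ℕ∞) (uncurry (derivs vs ψ)) := by
  induction vs generalizing ψ with
  | nil => exact h
  | cons v vs ih => exact ih (contDiff_uncurry_fderiv_apply h v)

/-- **Schwarz for `derivs`**: the first two directions may be swapped. [folklore] -/
theorem derivs_swap (v w : E) (vs : List E) {ψ : ℝ → E → ℝ}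
    (h : ContDiff ℝ ((⊤ : ℕ∞) : WithTop ℕ∞) (uncurry ψ)) :
    derivs (v :: w :: vs) ψ = derivs (w :: v :: vs) ψ := by
  simp only [derivs_cons]
  congr 1
  funext t x
  have h2 : ContDiff ℝ 2 (ψ t) := (contDiff_slice h t).of_le (by norm_cast)
  exact fderiv_fderiv_apply_comm h2 x w v

/-- **`derivs` depends only on the multiset of directions** (smooth fields). [folklore] -/
theorem derivs_perm {vs ws : List E} (hp : vs.Perm ws) {ψ : ℝ → E → ℝ}
    (h : ContDiff ℝ ((⊤ : ℕ∞) : WithTop ℕ∞) (uncurry ψ)) : derivs vs ψ = derivs ws ψ := by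
  induction hp generalizing ψ with
  | nil => rfl
  | cons v _ ih => simp only [derivs_cons]; exact ih (contDiff_uncurry_fderiv_apply h v)
  | swap v w vs => exact (derivs_swap w v vs h)
  | trans _ _ ih₁ ih₂ => exact (ih₁ h).trans (ih₂ h)

/-- **The last direction can be moved to the front**:
`derivs (v :: vs) ψ = ∂ᵥ(derivs vs ψ)` for smooth `ψ`. [folklore] -/
theorem derivs_cons_eq_fderiv_derivs (v : E) (vs : List E) {ψ : ℝ → E → ℝ}
    (h : ContDiff ℝ ((⊤ : ℕ∞) : WithTop ℕ∞) (uncurry ψ)) :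
    derivs (v :: vs) ψ = fun t x => fderiv ℝ (derivs vs ψ t) x v := by
  rw [derivs_perm (List.perm_append_singleton v vs).symm h, derivs_append_singleton]

/-- **`derivs` commutes with the slice Laplacian** (smooth fields). [folklore] -/
theorem derivs_laplacian [FiniteDimensional ℝ E] (vs : List E) {ψ : ℝ → E → ℝ}
    (h : ContDiff ℝ ((⊤ : ℕ∞) : WithTop ℕ∞) (uncurry ψ)) :
    derivs vs (fun t => Δ (ψ t)) = fun t => Δ (derivs vs ψ t) := by
  induction vs generalizing ψ with
  | nil => rfl
  | cons v vs ih =>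
    simp only [derivs_cons]
    have h3 : ∀ t, ContDiff ℝ 3 (ψ t) := fun t => (contDiff_slice h t).of_le (by norm_cast)
    have heq : (fun t x => fderiv ℝ (Δ (ψ t)) x v) = fun t => Δ (fun y => fderiv ℝ (ψ t) y v) := by
      funext t x
      exact fderiv_laplacian_apply (h3 t) x v
    rw [heq]
    exact ih (contDiff_uncurry_fderiv_apply h v)

/-- **`derivs` commutes with the time derivative** (smooth fields). [folklore] -/
theorem derivs_timeDeriv (vs : List E) {ψ : ℝ → E → ℝ}
    (h : ContDiff ℝ ((⊤ : ℕ∞) : WithTop ℕ∞) (uncurry ψ)) :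
    derivs vs (timeDeriv ψ) = timeDeriv (derivs vs ψ) := by
  induction vs generalizing ψ with
  | nil => rfl
  | cons v vs ih =>
    simp only [derivs_cons]
    have hS : IsSmoothSpaceTimeOn univ ψ := by
      rw [IsSmoothSpaceTimeOn, univ_prod_univ, contDiffOn_univ]; exact h
    have heq : (fun t x => fderiv ℝ (timeDeriv ψ t) x v) = timeDeriv (fun t x => fderiv ℝ (ψ t) x v) := by
      funext t x
      have e1 : timeDeriv ψ t = fun y => deriv (fun s => ψ s y) t := rfl
      rw [e1, timeDeriv_apply]
      exact (hS.deriv_fderiv_slice_eq_fderiv_deriv isOpen_univ (mem_univ t) x v).symm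
    rw [heq]
    exact ih (contDiff_uncurry_fderiv_apply h v)

/-- The slice Laplacian of a jointly smooth scalar field is jointly smooth. [folklore] -/
theorem contDiff_uncurry_laplacian [FiniteDimensional ℝ E] {ψ : ℝ → E → ℝ}
    (h : ContDiff ℝ ((⊤ : ℕ∞) : WithTop ℕ∞) (uncurry ψ)) :
    ContDiff ℝ ((⊤ : ℕ∞) : WithTop ℕ∞) (uncurry fun t => Δ (ψ t)) := by
  set b := stdOrthonormalBasis ℝ E
  have heq : (fun t => Δ (ψ t)) = fun t x => ∑ i, fderiv ℝ (fun y => fderiv ℝ (ψ t) y (b i)) x (b i) := by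
    funext t x
    exact laplacian_eq_sum_fderiv_fderiv b ((contDiff_slice h t).of_le (by norm_cast)) x
  rw [heq]
  have : uncurry (fun t x => ∑ i, fderiv ℝ (fun y => fderiv ℝ (ψ t) y (b i)) x (b i)) =
      fun q => ∑ i, uncurry (fun t x => fderiv ℝ (fun y => fderiv ℝ (ψ t) y (b i)) x (b i)) q := by
    funext q; rfl
  rw [this]
  exact ContDiff.sum fun i _ => contDiff_uncurry_fderiv_apply (contDiff_uncurry_fderiv_apply h (b i)) (b i)

/-- The time derivative of a jointly smooth field is jointly smooth. [folklore] -/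
theorem contDiff_uncurry_timeDeriv {ψ : ℝ → E → ℝ}
    (h : ContDiff ℝ ((⊤ : ℕ∞) : WithTop ℕ∞) (uncurry ψ)) :
    ContDiff ℝ ((⊤ : ℕ∞) : WithTop ℕ∞) (uncurry (timeDeriv ψ)) := by
  have hS : IsSmoothSpaceTimeOn univ ψ := by
    rw [IsSmoothSpaceTimeOn, univ_prod_univ, contDiffOn_univ]; exact h
  have h' := hS.isSmoothSpaceTimeOn_deriv isOpen_univ
  rw [IsSmoothSpaceTimeOn, univ_prod_univ, contDiffOn_univ] at h'
  exact h'

/-- `derivs vs (∂ₜψ + Δψ) = ∂ₜ(derivs vs ψ) + Δ(derivs vs ψ)` for smooth `ψ`. [folklore] -/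
theorem derivs_heatOp [FiniteDimensional ℝ E] (vs : List E) {ψ : ℝ → E → ℝ}
    (h : ContDiff ℝ ((⊤ : ℕ∞) : WithTop ℕ∞) (uncurry ψ)) :
    derivs vs (fun t x => timeDeriv ψ t x + (Δ (ψ t)) x) =
      fun t x => timeDeriv (derivs vs ψ) t x + (Δ (derivs vs ψ t)) x := by
  have hadd := derivs_add vs (ψ₁ := timeDeriv ψ) (ψ₂ := fun t => Δ (ψ t))
    (contDiff_uncurry_timeDeriv h) (contDiff_uncurry_laplacian h)
  have e : (fun t x => timeDeriv ψ t x + (Δ (ψ t)) x) =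
      fun t x => timeDeriv ψ t x + (fun t => Δ (ψ t)) t x := rfl
  rw [e, hadd, derivs_timeDeriv vs h, derivs_laplacian vs h]

end Commute

/-! ### Differentiated weak identities -/

section Equations

open scoped Laplacian RealInnerProductSpace

variable {E : Type*} [NormedAddCommGroup E] [InnerProductSpace ℝ E] [FiniteDimensional ℝ E]
  [MeasurableSpace E] [BorelSpace E]
variable {ι : Type*} [Fintype ι]

omit [MeasurableSpace E] [BorelSpace E] [FiniteDimensional ℝ E] in
/-- `⟪g, ∇ψ(x)⟫ = Σᵢ ⟪g, bᵢ⟫ ∂_{bᵢ}ψ(x)` in an orthonormal frame. [folklore] -/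
theorem inner_gradient_eq_sum_frame [CompleteSpace E] (b : OrthonormalBasis ι ℝ E) (g : E)
    (φ : E → ℝ) (x : E) : ⟪g, gradient φ x⟫ = ∑ i, ⟪g, b i⟫ * fderiv ℝ φ x (b i) := by
  conv_lhs => rw [← b.sum_repr' g]
  rw [sum_inner]
  refine Finset.sum_congr rfl fun i _ => ?_
  rw [real_inner_smul_left, HeatDivForm.real_inner_gradient_right, real_inner_comm]

/-- Components of a locally integrable field are locally integrable. [folklore] -/
theorem locallyIntegrableOn_inner_const {s : Set (ℝ × E)} {g : ℝ × E → E}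
    (hg : LocallyIntegrableOn g s volume) (v : E) :
    LocallyIntegrableOn (fun q => ⟪g q, v⟫) s volume := fun x hx => by
  obtain ⟨U, hU, hgU⟩ := hg x hx
  exact ⟨U, hU, hgU.inner_const v⟩

variable {Q : Opens (ℝ × E)}

omit [MeasurableSpace E] [BorelSpace E] in
/-- The heat operator of a test function on `Q` is a test function on `Q`. [folklore] -/
theorem _root_.Literature.Analysis.FluidPDE.IsSpaceTimeTestOn.heatOp {ψ : ℝ → E → ℝ}
    (hψ : IsSpaceTimeTestOn Q ψ) :
    IsSpaceTimeTestOn Q (fun t x => timeDeriv ψ t x + (Δ (ψ t)) x) := by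
  have hψtop : IsSpaceTimeTestOn (⊤ : Opens (ℝ × E)) ψ := hψ.mono le_top
  refine ⟨?_, ?_, ?_⟩
  · exact hψtop.timeDeriv_top.contDiff.add hψtop.laplacian_top.contDiff
  · exact hψtop.timeDeriv_top.hasCompactSupport.add hψtop.laplacian_top.hasCompactSupport
  · refine (closure_minimal (fun q hq => ?_) (isClosed_tsupport _)).trans hψ.tsupport_subset
    obtain ⟨t, x⟩ := q
    by_contra hq'
    exact hq (by
      show timeDeriv ψ t x + (Δ (ψ t)) x = 0
      rw [IsSpaceTimeTestOn.timeDeriv_eq_zero_of_notMem hq',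
        laplacian_slice_eq_zero_of_notMem_tsupport hq', add_zero])

omit [MeasurableSpace E] [BorelSpace E] in
/-- The slice Laplacian of a test function on `Q` is a test function on `Q`: the scalar case of
`IsSpaceTimeTestOn.laplacian_isSpaceTimeTestOn` (`DistributionalPressurePoisson.lean`), kept under
the short dot-notation name. [folklore] -/
theorem _root_.Literature.Analysis.FluidPDE.IsSpaceTimeTestOn.laplacian {ψ : ℝ → E → ℝ}
    (hψ : IsSpaceTimeTestOn Q ψ) : IsSpaceTimeTestOn Q (fun t => Δ (ψ t)) :=
  hψ.laplacian_isSpaceTimeTestOn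

/-- **Moving `∂^{vs}` from the test side onto flux representatives**: if `Gᵢ` represents
`∂^{vs}⟪g, bᵢ⟫` on `Q` then `(-1)^{|vs|} ∫ ⟪g, ∇(derivs vs ψ)⟫ = Σᵢ ∫ Gᵢ ∂_{bᵢ}ψ`. [folklore] -/
theorem integral_inner_gradient_derivs (b : OrthonormalBasis ι ℝ E) {g : ℝ × E → E}
    (hg : LocallyIntegrableOn g (Q : Set (ℝ × E)) volume)
    {vs : List E} {G : ι → ℝ × E → ℝ} (hG : ∀ i, IsRepDeriv Q (fun q => ⟪g q, b i⟫) vs (G i))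
    {ψ : ℝ → E → ℝ} (hψ : IsSpaceTimeTestOn Q ψ) :
    (-1) ^ vs.length * ∫ q : ℝ × E, ⟪g q, gradient (derivs vs ψ q.1) q.2⟫ =
      ∑ i, ∫ q : ℝ × E, G i q * fderiv ℝ (ψ q.1) q.2 (b i) := by
  set n := vs.length with hn
  have hD : IsSpaceTimeTestOn Q (derivs vs ψ) := hψ.derivs vs
  have hgi : ∀ i, LocallyIntegrableOn (fun q : ℝ × E => ⟪g q, b i⟫) (Q : Set (ℝ × E)) volume := fun i =>
    locallyIntegrableOn_inner_const hg (b i)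
  have hint : ∀ i, Integrable (fun q : ℝ × E => ⟪g q, b i⟫ * fderiv ℝ (derivs vs ψ q.1) q.2 (b i)) volume :=
    fun i => (isRepDeriv_nil (hgi i)).integrable_mul' (NSSpinHeat.isSpaceTimeTestOn_fderiv_apply hD (b i))
  have e1 : ∫ q : ℝ × E, ⟪g q, gradient (derivs vs ψ q.1) q.2⟫ =
      ∑ i, ∫ q : ℝ × E, ⟪g q, b i⟫ * fderiv ℝ (derivs vs ψ q.1) q.2 (b i) := by
    rw [← integral_finsetSum _ fun i _ => hint i]
    exact integral_congr_ae (Eventually.of_forall fun q => inner_gradient_eq_sum_frame b _ _ _)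
  have e2 : ∀ i, ∫ q : ℝ × E, ⟪g q, b i⟫ * fderiv ℝ (derivs vs ψ q.1) q.2 (b i) =
      (-1) ^ n * ∫ q : ℝ × E, G i q * fderiv ℝ (ψ q.1) q.2 (b i) := by
    intro i
    have h := (hG i).integral_eq (NSSpinHeat.isSpaceTimeTestOn_fderiv_apply hψ (b i))
    rw [← derivs_cons, derivs_cons_eq_fderiv_derivs (b i) vs hψ.contDiff] at h
    exact h
  have hsign : ((-1 : ℝ) ^ n) * ((-1 : ℝ) ^ n) = 1 := by rw [← mul_pow]; norm_num
  rw [e1, Finset.mul_sum]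
  refine Finset.sum_congr rfl fun i _ => ?_
  rw [e2 i, ← mul_assoc, hsign, one_mul]

/-- **Differentiating the weak heat equation with divergence-form right-hand side.** Let `h, g`
be locally integrable on `Q` with `∫ h(∂ₜψ + Δψ) = ∫ ⟪g, ∇ψ⟫` for all test functions on `Q`.
If `f` represents `∂^{vs}h` and, in an orthonormal frame `b`, `Gᵢ` represents `∂^{vs}⟪g, bᵢ⟫`,
then `∫ f(∂ₜψ + Δψ) = Σᵢ ∫ Gᵢ ∂_{bᵢ}ψ` for all test functions on `Q`: the derivative solves the
same equation with the differentiated flux (Schwartz 1950, Ch. II §1; the induction "as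
`∂ₜ(∂ⱼω) = νΔ(∂ⱼω) + ∂ⱼg`" of Lemarié-Rieusset 2016, Thm. 13.1, Step 2). [folklore] -/
theorem IsRepDeriv.heat_identity (b : OrthonormalBasis ι ℝ E) {h : ℝ × E → ℝ} {g : ℝ × E → E}
    (hg : LocallyIntegrableOn g (Q : Set (ℝ × E)) volume)
    (heq : ∀ ψ : ℝ → E → ℝ, IsSpaceTimeTestOn Q ψ →
      ∫ q : ℝ × E, h q * (timeDeriv ψ q.1 q.2 + (Δ (ψ q.1)) q.2) =
        ∫ q : ℝ × E, ⟪g q, gradient (ψ q.1) q.2⟫)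
    {vs : List E} {f : ℝ × E → ℝ} {G : ι → ℝ × E → ℝ} (hf : IsRepDeriv Q h vs f)
    (hG : ∀ i, IsRepDeriv Q (fun q => ⟪g q, b i⟫) vs (G i))
    {ψ : ℝ → E → ℝ} (hψ : IsSpaceTimeTestOn Q ψ) :
    ∫ q : ℝ × E, f q * (timeDeriv ψ q.1 q.2 + (Δ (ψ q.1)) q.2) =
      ∑ i, ∫ q : ℝ × E, G i q * fderiv ℝ (ψ q.1) q.2 (b i) := by
  set n := vs.length with hn
  have h1 := hf.integral_eq hψ.heatOp
  have hsign : ((-1 : ℝ) ^ n) * ((-1 : ℝ) ^ n) = 1 := by rw [← mul_pow]; norm_num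
  have h2 : ∫ q : ℝ × E, f q * (timeDeriv ψ q.1 q.2 + (Δ (ψ q.1)) q.2) =
      (-1) ^ n * ∫ q : ℝ × E, h q * derivs vs (fun t x => timeDeriv ψ t x + (Δ (ψ t)) x) q.1 q.2 := by
    rw [h1, ← mul_assoc, hsign, one_mul]
  rw [h2, derivs_heatOp vs hψ.contDiff, heq _ (hψ.derivs vs)]
  exact integral_inner_gradient_derivs b hg hG hψ

/-- **Differentiating a very weak Poisson identity in divergence form**: if
`∫ h Δψ = -∫ ⟪F, ∇ψ⟫` for all test functions on `Q`, `f` represents `∂^{vs}h` and `Φᵢ` represents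
`∂^{vs}⟪F, bᵢ⟫`, then `∫ f Δψ = -Σᵢ ∫ Φᵢ ∂_{bᵢ}ψ` (Schwartz 1950, Ch. II §1). [folklore] -/
theorem IsRepDeriv.poisson_identity (b : OrthonormalBasis ι ℝ E) {h : ℝ × E → ℝ} {F : ℝ × E → E}
    (hF : LocallyIntegrableOn F (Q : Set (ℝ × E)) volume)
    (heq : ∀ ψ : ℝ → E → ℝ, IsSpaceTimeTestOn Q ψ →
      ∫ q : ℝ × E, h q * (Δ (ψ q.1)) q.2 = -∫ q : ℝ × E, ⟪F q, gradient (ψ q.1) q.2⟫)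
    {vs : List E} {f : ℝ × E → ℝ} {Φ : ι → ℝ × E → ℝ} (hf : IsRepDeriv Q h vs f)
    (hΦ : ∀ i, IsRepDeriv Q (fun q => ⟪F q, b i⟫) vs (Φ i))
    {ψ : ℝ → E → ℝ} (hψ : IsSpaceTimeTestOn Q ψ) :
    ∫ q : ℝ × E, f q * (Δ (ψ q.1)) q.2 = -∑ i, ∫ q : ℝ × E, Φ i q * fderiv ℝ (ψ q.1) q.2 (b i) := by
  set n := vs.length with hn
  have h1 := hf.integral_eq hψ.laplacian
  have hsign : ((-1 : ℝ) ^ n) * ((-1 : ℝ) ^ n) = 1 := by rw [← mul_pow]; norm_num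
  have h2 : ∫ q : ℝ × E, f q * (Δ (ψ q.1)) q.2 =
      (-1) ^ n * ∫ q : ℝ × E, h q * derivs vs (fun t => Δ (ψ t)) q.1 q.2 := by
    rw [h1, ← mul_assoc, hsign, one_mul]
  rw [h2, derivs_laplacian vs hψ.contDiff, heq _ (hψ.derivs vs), mul_neg,
    integral_inner_gradient_derivs b hF hΦ hψ]

/-- **Differentiating a first-order identity** `Σ_m ∫ h_m ∂_{w_m}ψ = 0` (e.g. weak
incompressibility `Σ_b ∫ u_b ∂_bψ = 0`): if `f_m` represents `∂^{vs}h_m` for each `m`, then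
`Σ_m ∫ f_m ∂_{w_m}ψ = 0` (Schwartz 1950, Ch. II §1). [folklore] -/
theorem IsRepDeriv.sum_firstOrder_identity {κ : Type*} [Fintype κ] {hm fm : κ → ℝ × E → ℝ} {w : κ → E}
    (heq : ∀ ψ : ℝ → E → ℝ, IsSpaceTimeTestOn Q ψ →
      ∑ m, ∫ q : ℝ × E, hm m q * fderiv ℝ (ψ q.1) q.2 (w m) = 0)
    {vs : List E} (hf : ∀ m, IsRepDeriv Q (hm m) vs (fm m))
    {ψ : ℝ → E → ℝ} (hψ : IsSpaceTimeTestOn Q ψ) :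
    ∑ m, ∫ q : ℝ × E, fm m q * fderiv ℝ (ψ q.1) q.2 (w m) = 0 := by
  set n := vs.length with hn
  have hne : ((-1 : ℝ) ^ n) ≠ 0 := pow_ne_zero _ (by norm_num)
  have e : ∀ m, ∫ q : ℝ × E, fm m q * fderiv ℝ (ψ q.1) q.2 (w m) =
      ((-1 : ℝ) ^ n)⁻¹ * ∫ q : ℝ × E, hm m q * fderiv ℝ (derivs vs ψ q.1) q.2 (w m) := by
    intro m
    have h := (hf m).integral_eq (NSSpinHeat.isSpaceTimeTestOn_fderiv_apply hψ (w m))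
    rw [← derivs_cons, derivs_cons_eq_fderiv_derivs (w m) vs hψ.contDiff] at h
    rw [h, ← mul_assoc, inv_mul_cancel₀ hne, one_mul]
  simp_rw [e]
  rw [← Finset.mul_sum, heq _ (hψ.derivs vs), mul_zero]

end Equations

/-! ## The product rule for weak spatial derivatives -/

section ProductRule

open scoped Laplacian RealInnerProductSpace
open Literature.Analysis.FunctionSpaces

variable {E : Type*} [NormedAddCommGroup E] [InnerProductSpace ℝ E] [FiniteDimensional ℝ E]
  [MeasurableSpace E] [BorelSpace E]

omit [MeasurableSpace E] [BorelSpace E] [FiniteDimensional ℝ E] [InnerProductSpace ℝ E] in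
/-- Slice derivative versus total derivative: `D(φ(t, ·))(x) v = Dφ(t, x)(0, v)`. [folklore] -/
theorem fderiv_slice_apply_eq_fderiv [NormedSpace ℝ E] {φ : ℝ × E → ℝ} {q : ℝ × E}
    (hφ : DifferentiableAt ℝ φ q) (v : E) :
    fderiv ℝ (fun x => φ (q.1, x)) q.2 v = fderiv ℝ φ q ((0 : ℝ), v) := by
  have h : HasFDerivAt (fun x => φ (q.1, x)) ((fderiv ℝ φ q).comp (ContinuousLinearMap.inr ℝ ℝ E)) q.2 :=
    hφ.hasFDerivAt.comp q.2 (hasFDerivAt_prodMk_right q.1 q.2)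
  rw [h.fderiv]
  rfl

/-- **The reflected translate of a normalised bump is a space–time test function** on `Q` as soon
as the closed ball of its radius around the centre lies in `Q`. [folklore] -/
theorem isSpaceTimeTestOn_normed_comp_sub {Q : Opens (ℝ × E)} (ρ : ContDiffBump (0 : ℝ × E))
    {q : ℝ × E} (hq : closedBall q ρ.rOut ⊆ (Q : Set (ℝ × E))) :
    IsSpaceTimeTestOn Q (fun t x => ρ.normed volume (q - (t, x))) := by
  refine ⟨?_, ?_, ?_⟩
  · exact ρ.contDiff_normed.comp (contDiff_const.sub contDiff_id)
  · exact ρ.hasCompactSupport_normed.comp_homeomorph (Homeomorph.subLeft q)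
  · refine Subset.trans ?_ hq
    refine closure_minimal ?_ isClosed_closedBall
    intro y hy
    have hy' : q - y ∈ Function.support (ρ.normed volume) := hy
    rw [ρ.support_normed_eq, mem_ball, dist_zero_right] at hy'
    rw [mem_closedBall, dist_comm, dist_eq_norm]
    exact hy'.le

/-- **Mollification is bounded by the essential bound of the data.** [folklore] -/
theorem abs_normed_convolution_le (ρ : ContDiffBump (0 : ℝ × E)) {g : ℝ × E → ℝ} {K : ℝ}
    (hg : ∀ᵐ y ∂(volume : Measure (ℝ × E)), |g y| ≤ K)
    (q : ℝ × E) : |(ρ.normed volume ⋆[ContinuousLinearMap.lsmul ℝ ℝ, volume] g) q| ≤ K := by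
  haveI := isAddLeftInvariant_volume_real_prod (E := E)
  haveI := isNegInvariant_volume_real_prod (E := E)
  have hK0 : 0 ≤ K := by
    obtain ⟨y, hy⟩ := hg.exists
    exact (abs_nonneg _).trans hy
  rw [convolution_lsmul_real_prod_apply]
  have hae : ∀ᵐ w ∂(volume : Measure (ℝ × E)), |ρ.normed volume (q - w) * g w| ≤ ρ.normed volume (q - w) * K := by
    filter_upwards [hg] with w hw
    rw [abs_mul, abs_of_nonneg (ρ.nonneg_normed _)]
    exact mul_le_mul_of_nonneg_left hw (ρ.nonneg_normed _)
  calc |∫ w, ρ.normed volume (q - w) * g w| ≤ ∫ w, ρ.normed volume (q - w) * K := by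
        refine (abs_integral_le_integral_abs).trans (integral_mono_of_nonneg
          (Eventually.of_forall fun _ => abs_nonneg _) ?_ hae)
        exact ((ρ.integrable_normed.comp_sub_left q).mul_const K)
    _ = K := by
        rw [integral_mul_const, integral_sub_left_eq_self (ρ.normed volume) volume q, ρ.integral_normed,
          one_mul]

/-- **Directional derivatives of a mollification**: for integrable `g` and a bump `ρ`,
`D(ρ ⋆ g)(q) V = ∫ g(y) Dρ(q - y) V dy`. [folklore] -/
theorem fderiv_normed_convolution_apply (ρ : ContDiffBump (0 : ℝ × E)) {g : ℝ × E → ℝ}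
    (hg : Integrable g (volume : Measure (ℝ × E))) (q V : ℝ × E) :
    HasFDerivAt (ρ.normed volume ⋆[ContinuousLinearMap.lsmul ℝ ℝ, volume] g)
        (fderiv ℝ (ρ.normed volume ⋆[ContinuousLinearMap.lsmul ℝ ℝ, volume] g) q) q ∧
      fderiv ℝ (ρ.normed volume ⋆[ContinuousLinearMap.lsmul ℝ ℝ, volume] g) q V =
        ∫ y, g y * fderiv ℝ (ρ.normed volume) (q - y) V := by
  haveI := isAddLeftInvariant_volume_real_prod (E := E)
  haveI := isNegInvariant_volume_real_prod (E := E)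
  set ρn : ℝ × E → ℝ := ρ.normed volume with hρn
  have hρ1 : ContDiff ℝ 1 ρn := ρ.contDiff_normed
  have hρc : HasCompactSupport ρn := ρ.hasCompactSupport_normed
  have hD := hρc.hasFDerivAt_convolution_left (ContinuousLinearMap.lsmul ℝ ℝ) hρ1 hg.locallyIntegrable q
  refine ⟨hD.differentiableAt.hasFDerivAt, ?_⟩
  rw [hD.fderiv]
  have hint := (hρc.fderiv ℝ).convolutionExists_left
      ((ContinuousLinearMap.lsmul ℝ ℝ : ℝ →L[ℝ] ℝ →L[ℝ] ℝ).precompL (ℝ × E))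
      (hρ1.continuous_fderiv one_ne_zero) hg.locallyIntegrable q
  rw [convolution_def, ContinuousLinearMap.integral_apply hint.integrable V]
  simp only [ContinuousLinearMap.precompL_apply, ContinuousLinearMap.lsmul_apply, smul_eq_mul]
  rw [← integral_sub_left_eq_self (fun t => fderiv ℝ ρn t V * g (q - t)) volume q]
  refine integral_congr_ae (Eventually.of_forall fun y => ?_)
  simp only [sub_sub_cancel]
  ring

/-- **The spatial derivative of a mollification is the mollification of the weak spatial
derivative, inside** (Gilbarg–Trudinger 2001, Lemma 7.3 `Dᵅ(u_h) = (Dᵅu)_h`; here for one spatial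
direction in space–time). Let `C ⊆ Q` be measurable, `f, f_v` integrable on `C` with
`∫ f ∂ᵥψ = -∫ f_v ψ` for all test functions on `Q`, and `ρ` a bump with `B̄(q, r_out) ⊆ C`. Then
`∂ᵥ[(ρ ⋆ f𝟙_C)(t, ·)](x) = (ρ ⋆ f_v𝟙_C)(t, x)` at `q = (t, x)`. [folklore] -/
theorem fderiv_mollified_slice_eq {Q : Opens (ℝ × E)} {C : Set (ℝ × E)} (hCQ : C ⊆ (Q : Set (ℝ × E)))
    (hCm : MeasurableSet C) {f fv : ℝ × E → ℝ} (hf : IntegrableOn f C volume) {v : E}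
    (hweak : ∀ ψ : ℝ → E → ℝ, IsSpaceTimeTestOn Q ψ →
      ∫ q : ℝ × E, f q * fderiv ℝ (ψ q.1) q.2 v = -∫ q : ℝ × E, fv q * ψ q.1 q.2)
    (ρ : ContDiffBump (0 : ℝ × E)) {q : ℝ × E} (hq : closedBall q ρ.rOut ⊆ C) :
    fderiv ℝ (fun x => (ρ.normed volume ⋆[ContinuousLinearMap.lsmul ℝ ℝ, volume] C.indicator f) (q.1, x)) q.2 v =
      (ρ.normed volume ⋆[ContinuousLinearMap.lsmul ℝ ℝ, volume] C.indicator fv) q := by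
  set ρn : ℝ × E → ℝ := ρ.normed volume with hρn
  have hfi : Integrable (C.indicator f) (volume : Measure (ℝ × E)) := hf.integrable_indicator hCm
  have hρ1 : ContDiff ℝ 1 ρn := ρ.contDiff_normed
  obtain ⟨hD, hDV⟩ := fderiv_normed_convolution_apply ρ hfi q ((0 : ℝ), v)
  rw [fderiv_slice_apply_eq_fderiv hD.differentiableAt v, hDV]
  -- the test function `Θ = ρ(q - ·)` and its slice derivative
  set Θ : ℝ → E → ℝ := fun t x => ρn (q - (t, x)) with hΘ
  have hΘt : IsSpaceTimeTestOn Q Θ := isSpaceTimeTestOn_normed_comp_sub ρ (hq.trans hCQ)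
  have hΘsupp : tsupport (uncurry Θ) ⊆ closedBall q ρ.rOut := by
    refine closure_minimal ?_ isClosed_closedBall
    intro z hz
    have hz' : q - z ∈ Function.support (ρ.normed volume) := hz
    rw [ρ.support_normed_eq, mem_ball, dist_zero_right] at hz'
    rw [mem_closedBall, dist_comm, dist_eq_norm]
    exact hz'.le
  have hΘ0 : ∀ y ∉ C, y ∉ tsupport (uncurry Θ) := fun y hy h' => hy (hq (hΘsupp h'))
  have hdΘ : ∀ y : ℝ × E, fderiv ℝ (Θ y.1) y.2 v = -fderiv ℝ ρn (q - y) ((0 : ℝ), v) := by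
    intro y
    have hdy : DifferentiableAt ℝ (fun z : ℝ × E => ρn (q - z)) y :=
      ((hρ1.differentiable one_ne_zero) _).comp y ((differentiableAt_const _).sub differentiableAt_id)
    have h1 : fderiv ℝ (Θ y.1) y.2 v = fderiv ℝ (fun z : ℝ × E => ρn (q - z)) y ((0 : ℝ), v) :=
      fderiv_slice_apply_eq_fderiv hdy v
    rw [h1, fderiv_comp_const_sub]
    rfl
  have e2 : ∫ y, C.indicator f y * fderiv ℝ ρn (q - y) ((0 : ℝ), v) =
      -∫ y : ℝ × E, f y * fderiv ℝ (Θ y.1) y.2 v := by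
    rw [← integral_neg]
    refine integral_congr_ae (Eventually.of_forall fun y => ?_)
    show C.indicator f y * fderiv ℝ ρn (q - y) ((0 : ℝ), v) = -(f y * fderiv ℝ (Θ y.1) y.2 v)
    rw [hdΘ, mul_neg, neg_neg]
    by_cases hy : y ∈ C
    · rw [indicator_of_mem hy]
    · rw [indicator_of_notMem hy, zero_mul]
      have hy' := hΘ0 y hy
      have h0 : fderiv ℝ (Θ y.1) y.2 v = 0 := by
        obtain ⟨t, x⟩ := y
        rw [IsSpaceTimeTestOn.fderiv_slice_eq_zero_of_notMem hy']
        rfl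
      rw [hdΘ] at h0
      rw [neg_eq_zero.1 h0, mul_zero]
  rw [e2, hweak Θ hΘt, neg_neg, convolution_lsmul_real_prod_apply]
  refine integral_congr_ae (Eventually.of_forall fun y => ?_)
  show fv y * Θ y.1 y.2 = ρn (q - y) * C.indicator fv y
  by_cases hy : y ∈ C
  · rw [indicator_of_mem hy, mul_comm]
  · rw [indicator_of_notMem hy, mul_zero]
    have : Θ y.1 y.2 = 0 := image_eq_zero_of_notMem_tsupport (f := uncurry Θ) (hΘ0 y hy)
    rw [this, mul_zero]

/-- Bounded a.e. and measurable on an open set implies locally integrable there. [folklore] -/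
theorem locallyIntegrableOn_of_bound {Q : Opens (ℝ × E)} {f : ℝ × E → ℝ} {K : ℝ}
    (hfm : AEStronglyMeasurable f (volume.restrict (Q : Set (ℝ × E))))
    (hfb : ∀ᵐ q ∂(volume : Measure (ℝ × E)), q ∈ (Q : Set (ℝ × E)) → |f q| ≤ K) :
    LocallyIntegrableOn f (Q : Set (ℝ × E)) volume := by
  refine (locallyIntegrableOn_iff Q.isOpen.isLocallyClosed).2 fun C hCQ hCc => ?_
  haveI : IsFiniteMeasure ((volume : Measure (ℝ × E)).restrict C) :=
    isFiniteMeasure_restrict.2 hCc.measure_lt_top.ne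
  have hm : AEStronglyMeasurable f (volume.restrict C) := hfm.mono_measure (Measure.restrict_mono hCQ le_rfl)
  refine Integrable.mono' (integrable_const K) hm ?_
  rw [ae_restrict_iff' hCc.measurableSet]
  filter_upwards [hfb] with q hq hqC
  rw [Real.norm_eq_abs]
  exact hq (hCQ hqC)

set_option maxHeartbeats 1600000 in
/-- **Product rule for weak spatial derivatives of bounded functions** (Gilbarg–Trudinger 2001,
(7.18): `D(uv) = uDv + vDu` for `u, v ∈ W¹ ∩ L^∞`; Evans, *PDE*, §5.2.3 Thm. 1 (iv)). Let `f, k` be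
measurable and essentially bounded by `K` on the open set `Q ⊆ ℝ × E`, with weak spatial partial
derivatives `f_v, k_v ∈ L¹_loc(Q)` in the direction `v` (`IsRepDeriv Q f [v] f_v`, i.e.
`∫ f ∂ᵥψ = -∫ f_v ψ`). Then `fk` has the weak partial derivative `f_v k + f k_v`:
`∫ fk ∂ᵥψ = -∫ (f_v k + f k_v) ψ` for all test functions on `Q`. Proof: mollify `f` in space–time
(the derivative of the mollification is the mollification of `f_v` near the support of `ψ`,
`fderiv_mollified_slice_eq`), test the identity of `k` with the smooth product `f_ε ψ`, and pass to
the limit (dominated convergence, `f_ε → f` a.e. and boundedly; `ρ_ε ⋆ f_v → f_v` in `L¹`).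
[cite: GilbargTrudinger2001, (7.18)] -/
theorem IsRepDeriv.mul {Q : Opens (ℝ × E)} {f k fv kv : ℝ × E → ℝ} {v : E} {K : ℝ} (hK : 0 ≤ K)
    (hfm : AEStronglyMeasurable f (volume.restrict (Q : Set (ℝ × E))))
    (hkm : AEStronglyMeasurable k (volume.restrict (Q : Set (ℝ × E))))
    (hfb : ∀ᵐ q ∂(volume : Measure (ℝ × E)), q ∈ (Q : Set (ℝ × E)) → |f q| ≤ K)
    (hkb : ∀ᵐ q ∂(volume : Measure (ℝ × E)), q ∈ (Q : Set (ℝ × E)) → |k q| ≤ K)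
    (hfv : IsRepDeriv Q f [v] fv) (hkv : IsRepDeriv Q k [v] kv) :
    IsRepDeriv Q (fun q => f q * k q) [v] (fun q => fv q * k q + f q * kv q) := by
  haveI := isAddLeftInvariant_volume_real_prod (E := E)
  haveI := isNegInvariant_volume_real_prod (E := E)
  haveI : (volume : Measure (ℝ × E)).IsAddHaarMeasure := Measure.prod.instIsAddHaarMeasure _ _
  have hfloc : LocallyIntegrableOn f (Q : Set (ℝ × E)) volume := locallyIntegrableOn_of_bound hfm hfb
  have hkloc : LocallyIntegrableOn k (Q : Set (ℝ × E)) volume := locallyIntegrableOn_of_bound hkm hkb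
  -- local integrability of the product-rule expression
  have hprodloc : LocallyIntegrableOn (fun q => fv q * k q + f q * kv q) (Q : Set (ℝ × E)) volume := by
    refine (locallyIntegrableOn_iff Q.isOpen.isLocallyClosed).2 fun C hCQ hCc => ?_
    have h1 : IntegrableOn (fun q => fv q * k q) C volume := by
      refine Integrable.mul_bdd (hfv.2.1.integrableOn_compact_subset hCQ hCc)
        (hkm.mono_measure (Measure.restrict_mono hCQ le_rfl)) (c := K) ?_
      rw [ae_restrict_iff' hCc.measurableSet]
      filter_upwards [hkb] with q hq hqC
      rw [Real.norm_eq_abs]; exact hq (hCQ hqC)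
    have h2 : IntegrableOn (fun q => f q * kv q) C volume := by
      refine Integrable.bdd_mul (hkv.2.1.integrableOn_compact_subset hCQ hCc)
        (hfm.mono_measure (Measure.restrict_mono hCQ le_rfl)) (c := K) ?_
      rw [ae_restrict_iff' hCc.measurableSet]
      filter_upwards [hfb] with q hq hqC
      rw [Real.norm_eq_abs]; exact hq (hCQ hqC)
    exact h1.add h2
  have hfkloc : LocallyIntegrableOn (fun q => f q * k q) (Q : Set (ℝ × E)) volume := by
    refine locallyIntegrableOn_of_bound (K := K * K) (hfm.mul hkm) ?_
    filter_upwards [hfb, hkb] with q hq1 hq2 hqQ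
    rw [abs_mul]
    exact mul_le_mul (hq1 hqQ) (hq2 hqQ) (abs_nonneg _) hK
  refine ⟨hfkloc, hprodloc, fun ψ hψ => ?_⟩
  rw [show ((-1 : ℝ) ^ [v].length) = -1 by simp]
  simp only [derivs_cons, derivs_nil, neg_mul, one_mul]
  -- the compact neighbourhood `C` of the support of `ψ` inside `Q`
  set Kψ : Set (ℝ × E) := tsupport (uncurry ψ) with hKψ
  have hKc : IsCompact Kψ := hψ.hasCompactSupport
  have hKQ : Kψ ⊆ (Q : Set (ℝ × E)) := hψ.tsupport_subset
  obtain ⟨δ, hδ, hδQ⟩ := hKc.exists_cthickening_subset_open Q.isOpen hKQ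
  set C : Set (ℝ × E) := cthickening δ Kψ with hC
  have hCc : IsCompact C := hKc.cthickening
  have hCm : MeasurableSet C := isClosed_cthickening.measurableSet
  have hCQ : C ⊆ (Q : Set (ℝ × E)) := hδQ
  have hKC : Kψ ⊆ C := self_subset_cthickening _
  have hball : ∀ {r : ℝ}, r ≤ δ → ∀ q ∈ Kψ, closedBall q r ⊆ C := fun hr q hq y hy =>
    mem_cthickening_of_dist_le y q δ Kψ hq ((mem_closedBall.1 hy).trans hr)
  -- the data extended by zero off `C`
  have hfC : IntegrableOn f C volume := hfloc.integrableOn_compact_subset hCQ hCc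
  have hfvC : IntegrableOn fv C volume := hfv.2.1.integrableOn_compact_subset hCQ hCc
  set ft : ℝ × E → ℝ := C.indicator f with hft
  set fvt : ℝ × E → ℝ := C.indicator fv with hfvt
  have hfti : Integrable ft volume := hfC.integrable_indicator hCm
  have hfvti : Integrable fvt volume := hfvC.integrable_indicator hCm
  have hftb : ∀ᵐ y ∂(volume : Measure (ℝ × E)), |ft y| ≤ K := by
    filter_upwards [hfb] with y hy
    by_cases hyC : y ∈ C
    · rw [hft, indicator_of_mem hyC]; exact hy (hCQ hyC)
    · rw [hft, indicator_of_notMem hyC, abs_zero]; exact hK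
  -- a mollifier sequence with radii below `δ`
  obtain ⟨ρ₀, hρ₀lim, hρ₀ratio⟩ := exists_contDiffBump_seq (E := ℝ × E)
  obtain ⟨N, hN⟩ := Filter.eventually_atTop.1 (hρ₀lim.eventually (gt_mem_nhds hδ))
  set ρ : ℕ → ContDiffBump (0 : ℝ × E) := fun n => ρ₀ (n + N) with hρ
  have hρlim : Tendsto (fun n => (ρ n).rOut) atTop (𝓝 0) := hρ₀lim.comp (tendsto_add_atTop_nat N)
  have hρδ : ∀ n, (ρ n).rOut ≤ δ := fun n => (hN (n + N) (Nat.le_add_left N n)).le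
  have hρratio : ∀ n, (ρ n).rOut ≤ 2 * (ρ n).rIn := fun n => hρ₀ratio (n + N)
  -- the mollifications of `f` and of `f_v`
  set fn : ℕ → ℝ × E → ℝ := fun n => (ρ n).normed volume ⋆[ContinuousLinearMap.lsmul ℝ ℝ, volume] ft with hfn
  set gn : ℕ → ℝ × E → ℝ := fun n => (ρ n).normed volume ⋆[ContinuousLinearMap.lsmul ℝ ℝ, volume] fvt with hgn
  have hfns : ∀ n, ContDiff ℝ ((⊤ : ℕ∞) : WithTop ℕ∞) (fn n) := fun n =>
    ((ρ n).hasCompactSupport_normed (μ := volume)).contDiff_convolution_left _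
      ((ρ n).contDiff_normed) hfti.locallyIntegrable
  have hfnc : ∀ n, Continuous (fn n) := fun n => (hfns n).continuous
  have hgnc : ∀ n, Continuous (gn n) := fun n =>
    (((ρ n).hasCompactSupport_normed (μ := volume)).contDiff_convolution_left _
      ((ρ n).contDiff_normed (n := 0)) hfvti.locallyIntegrable).continuous
  have hfnb : ∀ n q, |fn n q| ≤ K := fun n q => abs_normed_convolution_le (ρ n) hftb q
  have hslice : ∀ n, ∀ q ∈ Kψ, fderiv ℝ (fun x => fn n (q.1, x)) q.2 v = gn n q := fun n q hq =>
    fderiv_mollified_slice_eq hCQ hCm hfC (fun ψ' hψ' => by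
      have h := hfv.integral_eq hψ'
      simpa using h) (ρ n) (hball (hρδ n) q hq)
  -- (1) a.e. convergence `fₙ → f̃` and `L¹` convergence `gₙ → f̃ᵥ`
  have hae : ∀ᵐ q ∂(volume : Measure (ℝ × E)), Tendsto (fun n => fn n q) atTop (𝓝 (ft q)) :=
    ContDiffBump.ae_convolution_tendsto_right_of_locallyIntegrable hρlim
      (Eventually.of_forall hρratio) hfti.locallyIntegrable
  have hL1 : Tendsto (fun n => (eLpNorm (gn n - fvt) 1 volume).toReal) atTop (𝓝 0) := by
    have h := tendsto_eLpNorm_normed_convolution_sub_self (μ := volume) hρlim le_rfl ENNReal.one_ne_top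
      (memLp_one_iff_integrable.2 hfvti)
    have h' := (ENNReal.tendsto_toReal ENNReal.zero_ne_top).comp h
    rwa [ENNReal.toReal_zero] at h'
  -- (2) the identity at level `n`: `∫ fₙ k ∂ᵥψ = -∫ kᵥ ψ fₙ - ∫ k ψ gₙ`
  have hdψ : IsSpaceTimeTestOn Q (fun t x => fderiv ℝ (ψ t) x v) := NSSpinHeat.isSpaceTimeTestOn_fderiv_apply hψ v
  have hψ0 : ∀ q ∉ Kψ, ψ q.1 q.2 = 0 := fun q hq => image_eq_zero_of_notMem_tsupport (f := uncurry ψ) hq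
  have hdψ0 : ∀ q ∉ Kψ, fderiv ℝ (ψ q.1) q.2 v = 0 := fun q hq => by
    obtain ⟨t, x⟩ := q
    rw [IsSpaceTimeTestOn.fderiv_slice_eq_zero_of_notMem hq]; rfl
  have hkψv : Integrable (fun q : ℝ × E => k q * fderiv ℝ (ψ q.1) q.2 v) volume :=
    (isRepDeriv_nil hkloc).integrable_mul' hdψ
  have hkvψ : Integrable (fun q : ℝ × E => kv q * ψ q.1 q.2) volume := hkv.integrable_mul' hψ
  have hkψ : Integrable (fun q : ℝ × E => k q * ψ q.1 q.2) volume := (isRepDeriv_nil hkloc).integrable_mul' hψ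
  have hident : ∀ n, ∫ q : ℝ × E, fn n q * k q * fderiv ℝ (ψ q.1) q.2 v =
      -(∫ q : ℝ × E, kv q * ψ q.1 q.2 * fn n q) - ∫ q : ℝ × E, k q * ψ q.1 q.2 * gn n q := by
    intro n
    have hΨ : IsSpaceTimeTestOn Q (fun t x => ψ t x * fn n (t, x)) := hψ.mul_smooth (hfns n)
    have hk := hkv.integral_eq hΨ
    rw [show ((-1 : ℝ) ^ [v].length) = -1 by simp] at hk
    simp only [derivs_cons, derivs_nil, neg_mul, one_mul] at hk
    -- expand the slice derivative of the product
    have hexp : ∀ q : ℝ × E, fderiv ℝ (fun x => ψ q.1 x * fn n (q.1, x)) q.2 v =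
        fderiv ℝ (ψ q.1) q.2 v * fn n q + ψ q.1 q.2 * gn n q := by
      intro q
      have hdψq : DifferentiableAt ℝ (ψ q.1) q.2 := ((hψ.contDiff_slice q.1).differentiable (by simp)) q.2
      have hdfq : DifferentiableAt ℝ (fun x => fn n (q.1, x)) q.2 :=
        (((hfns n).differentiable (by simp)).comp (differentiable_const _ |>.prodMk differentiable_id)) q.2
      rw [fderiv_fun_mul hdψq hdfq]
      simp only [_root_.add_apply, _root_.smul_apply, smul_eq_mul]
      by_cases hq : q ∈ Kψ
      · rw [hslice n q hq]; ring
      · rw [hψ0 q hq, hdψ0 q hq]; ring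
    simp_rw [hexp] at hk
    have i1 : Integrable (fun q : ℝ × E => k q * (fderiv ℝ (ψ q.1) q.2 v * fn n q)) volume := by
      have h := ((isRepDeriv_nil hkloc).integrable_mul' hdψ).mul_bdd (hfnc n).aestronglyMeasurable
        (c := K) (Eventually.of_forall fun q => by rw [Real.norm_eq_abs]; exact hfnb n q)
      exact h.congr (Eventually.of_forall fun q => by ring)
    -- `gₙ` is bounded on the compact support of `ψ`
    obtain ⟨Cg, hCg⟩ := hKc.exists_bound_of_continuousOn (hgnc n).continuousOn
    have i2 : Integrable (fun q : ℝ × E => k q * (ψ q.1 q.2 * gn n q)) volume := by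
      refine (hkψ.norm.mul_const |Cg|).mono' ?_ (Eventually.of_forall fun q => ?_)
      · exact (hkψ.1.mul (hgnc n).aestronglyMeasurable).congr (Eventually.of_forall fun q => by
          simp only [Pi.mul_apply]; ring)
      · by_cases hq : q ∈ Kψ
        · rw [show k q * (ψ q.1 q.2 * gn n q) = (k q * ψ q.1 q.2) * gn n q by ring, norm_mul]
          exact mul_le_mul_of_nonneg_left ((hCg q hq).trans (le_abs_self _)) (norm_nonneg _)
        · rw [hψ0 q hq]; simp
    have e0 : ∫ q : ℝ × E, k q * (fderiv ℝ (ψ q.1) q.2 v * fn n q + ψ q.1 q.2 * gn n q) =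
        (∫ q : ℝ × E, fn n q * k q * fderiv ℝ (ψ q.1) q.2 v) + ∫ q : ℝ × E, k q * ψ q.1 q.2 * gn n q := by
      rw [← integral_add (i1.congr (Eventually.of_forall fun q => by ring))
        (i2.congr (Eventually.of_forall fun q => by ring))]
      exact integral_congr_ae (Eventually.of_forall fun q => by ring)
    have e3 : ∫ q : ℝ × E, kv q * (ψ q.1 q.2 * fn n (q.1, q.2)) = ∫ q : ℝ × E, kv q * ψ q.1 q.2 * fn n q :=
      integral_congr_ae (Eventually.of_forall fun q => by simp only [Prod.mk.eta]; ring)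
    rw [e0, e3] at hk
    linarith
  -- (3) the three limits
  have hftf : ∀ q ∈ Kψ, ft q = f q := fun q hq => by rw [hft, indicator_of_mem (hKC hq)]
  -- (3a) `∫ fₙ k ∂ᵥψ → ∫ f k ∂ᵥψ`
  have hA : Tendsto (fun n => ∫ q : ℝ × E, fn n q * k q * fderiv ℝ (ψ q.1) q.2 v) atTop
      (𝓝 (∫ q : ℝ × E, f q * k q * fderiv ℝ (ψ q.1) q.2 v)) := by
    refine tendsto_integral_of_dominated_convergence (fun q => K * ‖k q * fderiv ℝ (ψ q.1) q.2 v‖)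
      (fun n => ?_) (hkψv.norm.const_mul K) (fun n => Eventually.of_forall fun q => ?_) ?_
    · exact (((hfnc n).aestronglyMeasurable.mul (hkψv.1))).congr (Eventually.of_forall fun q => by
        simp only [Pi.mul_apply]; ring)
    · rw [show fn n q * k q * fderiv ℝ (ψ q.1) q.2 v = fn n q * (k q * fderiv ℝ (ψ q.1) q.2 v) by ring,
        norm_mul, Real.norm_eq_abs]
      exact mul_le_mul_of_nonneg_right (hfnb n q) (norm_nonneg _)
    · filter_upwards [hae] with q hq
      by_cases hqK : q ∈ Kψ
      · have h := (hq.mul_const (k q * fderiv ℝ (ψ q.1) q.2 v))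
        rw [hftf q hqK] at h
        refine h.congr (fun n => by ring) |>.trans ?_
        rw [show f q * (k q * fderiv ℝ (ψ q.1) q.2 v) = f q * k q * fderiv ℝ (ψ q.1) q.2 v by ring]
      · simp only [hdψ0 q hqK, mul_zero]
        exact tendsto_const_nhds
  -- (3b) `∫ kᵥ ψ fₙ → ∫ kᵥ ψ f`
  have hB : Tendsto (fun n => ∫ q : ℝ × E, kv q * ψ q.1 q.2 * fn n q) atTop
      (𝓝 (∫ q : ℝ × E, kv q * ψ q.1 q.2 * f q)) := by
    refine tendsto_integral_of_dominated_convergence (fun q => ‖kv q * ψ q.1 q.2‖ * K)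
      (fun n => hkvψ.1.mul (hfnc n).aestronglyMeasurable) (hkvψ.norm.mul_const K)
      (fun n => Eventually.of_forall fun q => ?_) ?_
    · rw [norm_mul, Real.norm_eq_abs (fn n q)]
      exact mul_le_mul_of_nonneg_left (hfnb n q) (norm_nonneg _)
    · filter_upwards [hae] with q hq
      by_cases hqK : q ∈ Kψ
      · have h := hq.const_mul (kv q * ψ q.1 q.2)
        rwa [hftf q hqK] at h
      · simp only [hψ0 q hqK, mul_zero, zero_mul]
        exact tendsto_const_nhds
  -- (3c) `∫ k ψ gₙ → ∫ k ψ fᵥ`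
  obtain ⟨Mψ, hMψ0, hMψ⟩ := (hψ.mono le_top).exists_norm_le
  have hkψb : ∀ᵐ q ∂(volume : Measure (ℝ × E)), ‖k q * ψ q.1 q.2‖ ≤ K * Mψ := by
    filter_upwards [hkb] with q hq
    rw [norm_mul]
    by_cases hqK : q ∈ Kψ
    · rw [Real.norm_eq_abs]
      exact mul_le_mul (hq (hKQ hqK)) (hMψ q.1 q.2) (norm_nonneg _) hK
    · rw [hψ0 q hqK, norm_zero, mul_zero]; positivity
  have hgni : ∀ n, Integrable (gn n) (volume : Measure (ℝ × E)) := by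
    intro n
    haveI := isAddRightInvariant_volume_real_prod (E := E)
    exact (ρ n).integrable_normed.integrable_convolution (ContinuousLinearMap.lsmul ℝ ℝ) hfvti
  have hC : Tendsto (fun n => ∫ q : ℝ × E, k q * ψ q.1 q.2 * gn n q) atTop
      (𝓝 (∫ q : ℝ × E, k q * ψ q.1 q.2 * fv q)) := by
    have hlim_eq : ∫ q : ℝ × E, k q * ψ q.1 q.2 * fv q = ∫ q : ℝ × E, k q * ψ q.1 q.2 * fvt q := by
      refine integral_congr_ae (Eventually.of_forall fun q => ?_)
      show k q * ψ q.1 q.2 * fv q = k q * ψ q.1 q.2 * fvt q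
      by_cases hqK : q ∈ Kψ
      · rw [hfvt, indicator_of_mem (hKC hqK)]
      · rw [hψ0 q hqK]; simp
    rw [hlim_eq, tendsto_iff_norm_sub_tendsto_zero]
    have hint_n : ∀ n, Integrable (fun q : ℝ × E => k q * ψ q.1 q.2 * gn n q) volume := fun n =>
      (hgni n).bdd_mul hkψ.1 hkψb
    have hint_lim : Integrable (fun q : ℝ × E => k q * ψ q.1 q.2 * fvt q) volume :=
      hfvti.bdd_mul hkψ.1 hkψb
    have hbound : ∀ n, ‖(∫ q : ℝ × E, k q * ψ q.1 q.2 * gn n q) - ∫ q : ℝ × E, k q * ψ q.1 q.2 * fvt q‖ ≤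
        K * Mψ * (eLpNorm (gn n - fvt) 1 volume).toReal := by
      intro n
      rw [← integral_sub (hint_n n) hint_lim]
      have hgi : Integrable (fun q => ‖(gn n - fvt) q‖) (volume : Measure (ℝ × E)) := ((hgni n).sub hfvti).norm
      calc ‖∫ q : ℝ × E, (k q * ψ q.1 q.2 * gn n q - k q * ψ q.1 q.2 * fvt q)‖
          ≤ ∫ q : ℝ × E, K * Mψ * ‖(gn n - fvt) q‖ := by
            refine norm_integral_le_of_norm_le (hgi.const_mul _) ?_
            filter_upwards [hkψb] with q hq
            rw [show k q * ψ q.1 q.2 * gn n q - k q * ψ q.1 q.2 * fvt q = (k q * ψ q.1 q.2) * (gn n - fvt) q by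
              simp only [Pi.sub_apply]; ring, norm_mul]
            exact mul_le_mul_of_nonneg_right hq (norm_nonneg _)
        _ = K * Mψ * (eLpNorm (gn n - fvt) 1 volume).toReal := by
            rw [integral_const_mul, integral_norm_eq_lintegral_enorm ((hgni n).sub hfvti).1,
              eLpNorm_one_eq_lintegral_enorm]
    refine squeeze_zero (fun n => norm_nonneg _) hbound ?_
    simpa using hL1.const_mul (K * Mψ)
  -- (4) conclusion: pass to the limit in the identity
  have hA' : Tendsto (fun n => ∫ q : ℝ × E, fn n q * k q * fderiv ℝ (ψ q.1) q.2 v) atTop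
      (𝓝 (-(∫ q : ℝ × E, kv q * ψ q.1 q.2 * f q) - ∫ q : ℝ × E, k q * ψ q.1 q.2 * fv q)) := by
    have h := (hB.neg).sub hC
    refine h.congr fun n => ?_
    exact (hident n).symm
  have hlim := tendsto_nhds_unique hA hA'
  -- rewrite the right-hand side of the goal
  have j1 : Integrable (fun q : ℝ × E => fv q * k q * ψ q.1 q.2) volume := by
    have h : Integrable (fun q : ℝ × E => k q * ψ q.1 q.2 * fvt q) volume := hfvti.bdd_mul hkψ.1 hkψb
    refine h.congr (Eventually.of_forall fun q => ?_)
    show k q * ψ q.1 q.2 * fvt q = fv q * k q * ψ q.1 q.2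
    by_cases hqC : q ∈ C
    · rw [hfvt, indicator_of_mem hqC]; ring
    · rw [hψ0 q fun h => hqC (hKC h)]; simp
  have j2 : Integrable (fun q : ℝ × E => f q * kv q * ψ q.1 q.2) volume := by
    have h : Integrable (fun q : ℝ × E => ft q * (kv q * ψ q.1 q.2)) volume :=
      hkvψ.bdd_mul hfti.1 (hftb.mono fun q hq => by rw [Real.norm_eq_abs]; exact hq)
    refine h.congr (Eventually.of_forall fun q => ?_)
    show ft q * (kv q * ψ q.1 q.2) = f q * kv q * ψ q.1 q.2
    by_cases hqC : q ∈ C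
    · rw [hft, indicator_of_mem hqC]; ring
    · rw [hψ0 q fun h => hqC (hKC h)]; simp
  have eR : ∫ q : ℝ × E, (fv q * k q + f q * kv q) * ψ q.1 q.2 =
      (∫ q : ℝ × E, k q * ψ q.1 q.2 * fv q) + ∫ q : ℝ × E, kv q * ψ q.1 q.2 * f q := by
    have e1 : ∫ q : ℝ × E, k q * ψ q.1 q.2 * fv q = ∫ q : ℝ × E, fv q * k q * ψ q.1 q.2 :=
      integral_congr_ae (Eventually.of_forall fun q => by ring)
    have e2 : ∫ q : ℝ × E, kv q * ψ q.1 q.2 * f q = ∫ q : ℝ × E, f q * kv q * ψ q.1 q.2 :=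
      integral_congr_ae (Eventually.of_forall fun q => by ring)
    rw [e1, e2, ← integral_add j1 j2]
    exact integral_congr_ae (Eventually.of_forall fun q => by ring)
  rw [eR, hlim]
  ring

end ProductRule

end RepDeriv

end Literature.Analysis.FluidPDE

end
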